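import Summits.QuantumFields.YangMills.Theorems.FlatTubeReductionGaussProfileNumbers
import Summits.QuantumFields.YangMills.Theorems.FlatTubeReductionOrthoDensity
import Summits.QuantumFields.YangMills.Theorems.FlatTubeReductionGaussianLayerCake
import HarnessLib

/-!
# GAUSSIAN PROFILE NUMBERS II: the REAL transfer form of (E′)-lite, the flat MASTER MOMENT bound `∫ e^{−aN}(N+1)^k ≤ K_{a,k}·v_β`, the transverse master bound
# `∫ f dπ ≤ C·D·K_{a,k}·v_β` for `0 ≤ f ≤ D·e^{−aN}(N+1)^k` supported at the record radius, and the CORE FLOOR `k₀·v_β ≤ ∫_{coreBox β} recordProfile dπ`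
# (route `FlatTubeReduction`, crux K1 `NearFlatRatioLaw` stmt-QuantumFields-24720; seat `ym-line-ftr-p1` g17; rate twin «ratepack-v5»; R2b1 RECORD rung — no summit statement is proved here)

WHY (memo `Cruxes/NearFlatRatioLaw/Lines/ratepack-v5-nearpair-g16.md` §6 (P1)).  The seven scalar «profile numbers» of `…ExactDressingOfProfileNumbersSq.exactDressing_of_profileNumbers_sq`
for the record profile at fibre radius `r_B = min (1/40) (β^{-1/2}·btLog β)` are ratios `∫ Ω·M dπ / ∫_{core} Ω dπ` with polynomial weights `M ≤ D(N+1)^k` in the anisotropic level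
`N = balLevel β` (`…GaussProfileNumbers`: `e^{−50N} ≤ Ω ≤ e^{−c_L N}`, `vol{N ≤ t} ≤ v_β(t+1)^d`).  This file turns those two facts into the two bounds every profile number needs:
numerator `≤ (const)·v_β` and denominator `≥ k₀·v_β`, with the `β`-dependent unit sublevel volume `v_β = vol{N∘balExt ≤ 1}` on both sides (it cancels in the sequel).
* §1 `norm_le_norm_balExt`, ★★ `orthoTransverse_integral_two_sided` — (E′)-lite for REAL integrals: `c·∫ f∘balExt dvol ≤ ∫ f dπ ≤ C·∫ f∘balExt dvol` for measurable bounded `f ≥ 0`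
  vanishing off a small sup-ball (from `…OrthoDensity.orthoTransverse_lintegral_two_sided`, `integral_eq_lintegral_of_nonneg_ae`, `lintegral_map`);
* §2 `add_one_pow_le_of_scaled`, `exp_neg_mul_pow_le_scaled`, `exp_neg_mul_pow_le_const` (pointwise rescaling / boundedness of the layer-cake integrand), `volume_real_scaled_sublevel_le`,
  ★★ `flat_gauss_moment_le` — `∫_{closedBall 0 1} e^{−aN∘balExt}(aN∘balExt+1)^k dvol ≤ 5e·2^k4^d k!d!·(v_β·a^{−d})` (`0 < a ≤ 1`; g12's
  `…GaussianLayerCake.integral_exp_neg_mul_pow_le_of_volume_growth` on the finite measure `vol|closedBall 0 1`);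
* §3 `norm_le_norm_linkEmbed`, `mem_closedBall_of_linkEmbed_le`, `eventually_recordRadius_lt`, ★★★ `orthoTransverse_gauss_moment_le` — THE TRANSVERSE MASTER BOUND: `∃ K > 0, β₁ ≥ 1`,
  for `β ≥ β₁`, `0 < a ≤ 1`, `k`, `D ≥ 0` and every measurable `0 ≤ f ≤ D·e^{−a·balLevel β}(balLevel β+1)^k` with `f v ≠ 0 → ‖linkEmbed v‖ ≤ r_B(β)`:
  `∫ f dπ ≤ K·D·(5e·2^k4^d k!d!)·(a^{k+d})⁻¹·v_β`;
* §4 `le_add_one_of_sq_le`, `sqrt_mul_norm_pow_le_balLevel_add_one` (`(√β‖x‖)^m ≤ (N+1)^m`), `one_add_mul_norm_sq_pow_le` (`(1+β‖x‖²)^m ≤ (N+1)^m`), `mem_coreBox_of_balLevel_le`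
  (the quarter-sublevel of `N` lies in `coreBox β`, is capped, and lies in the support ball; `β ≥ 400`), `measurableSet_coreBox`, `volume_real_sublevel_quarter`, `volume_real_sublevel_one_pos`,
  ★★★ `recordProfile_core_floor` — THE CORE FLOOR: `∃ k₀ > 0, β₂ ≥ 400, ∀ β ≥ β₂, k₀·v_β ≤ ∫_{coreBox β} recordProfile β (linkEmbed v) dπ`.
HONEST FRAMING: elementary measure theory on top of (E′)-lite; the seven facts and `exactDressing_of_recordProfile` are the NEXT file; femto rung R2b1 (RECORD label); not infinite volume,
not a gap, not Clay.  No defs, no named facts, no `sorry`.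
-/

set_option autoImplicit false

noncomputable section

open MeasureTheory Filter Topology Real
open scoped BigOperators ENNReal
open Literature.MathematicalPhysics.QuantumFieldTheory
open Literature.MathematicalPhysics.QuantumLattice

namespace Summit.QuantumFields.YangMills.Theorems.FemtoTransferGap.TwoLattice.ConstTube

open Summit.QuantumFields.YangMills.Theorems.FemtoTransferGap
open Summit.QuantumFields.YangMills.Theorems.FemtoTransferGap.TwoLattice.Stiff (LinkSpace)
open Summit.QuantumFields.YangMills.Theorems.FemtoTransferGap.TwoLattice.Toron
open Summit.QuantumFields.YangMills.Theorems.FemtoTransferGap.RateTube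

variable (L : ℕ) [NeZero L]

/-! ## §1 (E′)-lite for real integrals -/

/-- The coordinates of `w` are coordinates of `balExt L w`: `‖w‖ ≤ ‖balExt L w‖` (sup norms). [folklore] -/
theorem norm_le_norm_balExt (w : {e : Edge 3 L // ¬e.1 = 0} → Fin 3 → ℝ) : ‖w‖ ≤ ‖balExt L w‖ := by
  refine (pi_norm_le_iff_of_nonneg (norm_nonneg _)).2 fun e' => ?_
  have h4 : balExt L w e'.1 = w e' := funext fun a => by rw [balExt_apply, dif_neg e'.2]
  rw [← h4]; exact norm_le_pi_norm (balExt L w) e'.1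

/-- ★★ **(E′)-lite, REAL INTEGRAL FORM**: there are `r₀ > 0` and real constants `0 < c`, `0 < C` such that for every measurable, nonnegative, bounded `f` vanishing off the sup-ball
`ball 0 r₀`:  `c·∫ f (balExt L w) dw ≤ ∫ f dπ ≤ C·∫ f (balExt L w) dw` (`π = orthoTransverse L`; `∫ … dw` = Lebesgue integral over the off-base coordinates). [cite: Luscher1983, §3] -/
theorem orthoTransverse_integral_two_sided :
    ∃ r₀ : ℝ, 0 < r₀ ∧ ∃ c C : ℝ, 0 < c ∧ 0 < C ∧ ∀ f : (Edge 3 L → Fin 3 → ℝ) → ℝ, Measurable f → (∀ v, 0 ≤ f v) → (∃ B : ℝ, ∀ v, f v ≤ B) →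
      (∀ v, f v ≠ 0 → ‖v‖ < r₀) →
      c * ∫ w, f (balExt L w) ≤ ∫ v, f v ∂orthoTransverse L ∧ ∫ v, f v ∂orthoTransverse L ≤ C * ∫ w, f (balExt L w) := by
  haveI := isFiniteMeasure_orthoTransverse L
  obtain ⟨r₀, hr₀, c, C, hc, hC, h⟩ := orthoTransverse_lintegral_two_sided L
  have hc1 : min c 1 ≠ ⊤ := ne_top_of_le_ne_top ENNReal.one_ne_top (min_le_right _ _)
  have hc0 : min c 1 ≠ 0 := (lt_min hc one_pos).ne'
  have hC1 : max C 1 ≠ ⊤ := max_ne_top hC.ne ENNReal.one_ne_top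
  refine ⟨r₀, hr₀, (min c 1).toReal, (max C 1).toReal, ENNReal.toReal_pos hc0 hc1,
    ENNReal.toReal_pos (ne_of_gt (lt_max_of_lt_right one_pos)) hC1, fun f hf hf0 hfB hfs => ?_⟩
  obtain ⟨B, hB⟩ := hfB
  have hB0 : 0 ≤ B := (hf0 0).trans (hB 0)
  set F : (Edge 3 L → Fin 3 → ℝ) → ℝ≥0∞ := fun v => ENNReal.ofReal (f v) with hF
  have hFm : Measurable F := ENNReal.measurable_ofReal.comp hf
  have hFs : ∀ v, F v ≠ 0 → ‖v‖ < r₀ := fun v hv => hfs v fun h0 => hv (by rw [hF]; simp [h0])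
  have hFB : ∀ v, F v ≤ ENNReal.ofReal B := fun v => ENNReal.ofReal_le_ofReal (hB v)
  obtain ⟨hlo, hup⟩ := h F hFm hFs
  -- the two real integrals as `toReal` of lintegrals
  have hπ : ∫ v, f v ∂orthoTransverse L = (∫⁻ v, F v ∂orthoTransverse L).toReal :=
    integral_eq_lintegral_of_nonneg_ae (ae_of_all _ hf0) hf.aestronglyMeasurable
  have hν : ∫ w, f (balExt L w) = (∫⁻ v, F v ∂balLebesgue L).toReal := by
    rw [balLebesgue, lintegral_map hFm (balExt L).continuous.measurable]
    exact integral_eq_lintegral_of_nonneg_ae (ae_of_all _ fun w => hf0 _) (hf.comp (balExt L).continuous.measurable).aestronglyMeasurable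
  -- finiteness
  have hπfin : ∫⁻ v, F v ∂orthoTransverse L ≠ ⊤ := by
    refine ne_top_of_le_ne_top ?_ (lintegral_mono hFB)
    rw [lintegral_const]; exact ENNReal.mul_ne_top ENNReal.ofReal_ne_top (measure_ne_top _ _)
  have hνfin : ∫⁻ v, F v ∂balLebesgue L ≠ ⊤ := by
    rw [balLebesgue, lintegral_map hFm (balExt L).continuous.measurable]
    have hind : ∀ w, F (balExt L w) ≤ (Metric.ball (0 : {e : Edge 3 L // ¬e.1 = 0} → Fin 3 → ℝ) r₀).indicator (fun _ => ENNReal.ofReal B) w := fun w => by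
      by_cases hw : F (balExt L w) = 0
      · rw [hw]; exact bot_le
      · have hwb : w ∈ Metric.ball (0 : {e : Edge 3 L // ¬e.1 = 0} → Fin 3 → ℝ) r₀ :=
          mem_ball_zero_iff.2 ((norm_le_norm_balExt L w).trans_lt (hFs _ hw))
        rw [Set.indicator_of_mem hwb]; exact hFB _
    refine ne_top_of_le_ne_top ?_ (lintegral_mono hind)
    rw [lintegral_indicator measurableSet_ball, setLIntegral_const]
    exact ENNReal.mul_ne_top ENNReal.ofReal_ne_top measure_ball_lt_top.ne
  rw [hπ, hν, ← ENNReal.toReal_mul, ← ENNReal.toReal_mul]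
  exact ⟨ENNReal.toReal_mono hπfin ((mul_le_mul_left (min_le_left _ _) _).trans hlo),
    ENNReal.toReal_mono (ENNReal.mul_ne_top hC1 hνfin) (hup.trans (mul_le_mul_left (le_max_left _ _) _))⟩

/-! ## §2 The flat master moment bound -/

/-- `(N + 1)^k ≤ a^{−k}·(aN + 1)^k` for `0 < a ≤ 1`, `N ≥ 0`. [folklore] -/
theorem add_one_pow_le_of_scaled {a N : ℝ} (ha0 : 0 < a) (ha1 : a ≤ 1) (hN : 0 ≤ N) (k : ℕ) : (N + 1) ^ k ≤ (a ^ k)⁻¹ * (a * N + 1) ^ k := by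
  rw [← inv_pow, ← mul_pow]
  refine pow_le_pow_left₀ (by positivity) ?_ k
  rw [le_inv_mul_iff₀ ha0]
  nlinarith

/-- `e^{−aN}(N+1)^k ≤ a^{−k}·e^{−aN}(aN+1)^k` (the layer-cake integrand in the rescaled level `N' = aN`). [folklore] -/
theorem exp_neg_mul_pow_le_scaled {a N : ℝ} (ha0 : 0 < a) (ha1 : a ≤ 1) (hN : 0 ≤ N) (k : ℕ) :
    Real.exp (-(a * N)) * (N + 1) ^ k ≤ (a ^ k)⁻¹ * (Real.exp (-(a * N)) * (a * N + 1) ^ k) := by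
  have h := add_one_pow_le_of_scaled ha0 ha1 hN k
  have he := Real.exp_pos (-(a * N))
  calc Real.exp (-(a * N)) * (N + 1) ^ k ≤ Real.exp (-(a * N)) * ((a ^ k)⁻¹ * (a * N + 1) ^ k) := mul_le_mul_of_nonneg_left h he.le
    _ = _ := by ring

/-- `e^{−aN}(N+1)^k ≤ a^{−k}·2^k·k!·e^{1/2}` — the layer-cake integrand is bounded. [folklore] -/
theorem exp_neg_mul_pow_le_const {a N : ℝ} (ha0 : 0 < a) (ha1 : a ≤ 1) (hN : 0 ≤ N) (k : ℕ) :
    Real.exp (-(a * N)) * (N + 1) ^ k ≤ (a ^ k)⁻¹ * (2 ^ k * k.factorial * Real.exp (1 / 2)) := by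
  refine (exp_neg_mul_pow_le_scaled ha0 ha1 hN k).trans (mul_le_mul_of_nonneg_left ?_ (by positivity))
  have h := pow_mul_exp_neg_le (N := a * N) (by positivity) k
  have h1 : Real.exp (-(a * N / 2)) ≤ 1 := Real.exp_le_one_iff.mpr (by nlinarith)
  rw [mul_comm]
  calc (a * N + 1) ^ k * Real.exp (-(a * N)) ≤ 2 ^ k * k.factorial * Real.exp (1 / 2) * Real.exp (-(a * N / 2)) := h
    _ ≤ 2 ^ k * k.factorial * Real.exp (1 / 2) * 1 := mul_le_mul_of_nonneg_left h1 (by positivity)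
    _ = _ := mul_one _

/-- The volume-growth hypothesis for the rescaled level `N' = a·balLevel β ∘ balExt` on `vol|closedBall 0 1`: `μ.real{N' ≤ t} ≤ (v_β·a^{−d})·(t+1)^d` (`0 < a ≤ 1`, `β ≥ 1`). [folklore] -/
theorem volume_real_scaled_sublevel_le {β : ℝ} (hβ : 1 ≤ β) {a : ℝ} (ha0 : 0 < a) (ha1 : a ≤ 1) {t : ℝ} (ht : 0 ≤ t) :
    ((volume : Measure ({e : Edge 3 L // ¬e.1 = 0} → Fin 3 → ℝ)).restrict (Metric.closedBall 0 1)).real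
        {w | a * balLevel L β (balExt L w) ≤ t} ≤
      (volume {w : {e : Edge 3 L // ¬e.1 = 0} → Fin 3 → ℝ | balLevel L β (balExt L w) ≤ 1}).toReal *
          (a ^ Module.finrank ℝ ({e : Edge 3 L // ¬e.1 = 0} → Fin 3 → ℝ))⁻¹ *
        (t + 1) ^ Module.finrank ℝ ({e : Edge 3 L // ¬e.1 = 0} → Fin 3 → ℝ) := by
  set d := Module.finrank ℝ ({e : Edge 3 L // ¬e.1 = 0} → Fin 3 → ℝ)
  have hset : {w : {e : Edge 3 L // ¬e.1 = 0} → Fin 3 → ℝ | a * balLevel L β (balExt L w) ≤ t} =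
      {w : {e : Edge 3 L // ¬e.1 = 0} → Fin 3 → ℝ | balLevel L β (balExt L w) ≤ t / a} := by
    ext w; simp only [Set.mem_setOf_eq]; rw [le_div_iff₀ ha0, mul_comm]
  have hta : 0 ≤ t / a := div_nonneg ht ha0.le
  have hfin : volume {w : {e : Edge 3 L // ¬e.1 = 0} → Fin 3 → ℝ | balLevel L β (balExt L w) ≤ t / a} ≠ ⊤ := by
    have hta1 : 0 < t / a + 1 := by linarith
    have hmono : volume {w : {e : Edge 3 L // ¬e.1 = 0} → Fin 3 → ℝ | balLevel L β (balExt L w) ≤ t / a} ≤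
        volume {w : {e : Edge 3 L // ¬e.1 = 0} → Fin 3 → ℝ | balLevel L β (balExt L w) ≤ t / a + 1} := measure_mono fun w (hw : _ ≤ t / a) => hw.trans (by linarith)
    rw [volume_sublevel_eq L β hta1] at hmono
    exact ne_top_of_le_ne_top (ENNReal.mul_ne_top ENNReal.ofReal_ne_top (volume_sublevel_one_lt_top L hβ).ne) hmono
  have h1 : ((volume : Measure ({e : Edge 3 L // ¬e.1 = 0} → Fin 3 → ℝ)).restrict (Metric.closedBall 0 1)).real {w | a * balLevel L β (balExt L w) ≤ t} ≤
      (volume {w : {e : Edge 3 L // ¬e.1 = 0} → Fin 3 → ℝ | balLevel L β (balExt L w) ≤ t / a}).toReal := by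
    rw [measureReal_def, hset]
    exact ENNReal.toReal_mono hfin (Measure.restrict_le_self _)
  have h2 := volume_real_sublevel_le L hβ hta
  have h3 : (t / a + 1) ^ d ≤ (a ^ d)⁻¹ * (t + 1) ^ d := by
    rw [← inv_pow, ← mul_pow]
    refine pow_le_pow_left₀ (by positivity) ?_ d
    rw [le_inv_mul_iff₀ ha0, mul_add, mul_div_cancel₀ _ ha0.ne']
    nlinarith
  have hv0 : 0 ≤ (volume {w : {e : Edge 3 L // ¬e.1 = 0} → Fin 3 → ℝ | balLevel L β (balExt L w) ≤ 1}).toReal := ENNReal.toReal_nonneg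
  calc _ ≤ _ := h1
    _ ≤ _ := h2
    _ ≤ (volume {w : {e : Edge 3 L // ¬e.1 = 0} → Fin 3 → ℝ | balLevel L β (balExt L w) ≤ 1}).toReal * ((a ^ d)⁻¹ * (t + 1) ^ d) := mul_le_mul_of_nonneg_left h3 hv0
    _ = _ := by ring

/-- ★★ **THE FLAT MASTER MOMENT BOUND**: for `β ≥ 1`, `0 < a ≤ 1`, `k : ℕ`:
`∫_{closedBall 0 1} e^{−a·N(balExt w)}·(a·N(balExt w)+1)^k dw ≤ 5e·2^k·4^d·k!·d!·(v_β·a^{−d})`, `N = balLevel β`, `v_β = vol{N∘balExt ≤ 1}`, `d` the flat dimension. [folklore] -/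
theorem flat_gauss_moment_le {β : ℝ} (hβ : 1 ≤ β) {a : ℝ} (ha0 : 0 < a) (ha1 : a ≤ 1) (k : ℕ) :
    ∫ w in Metric.closedBall (0 : {e : Edge 3 L // ¬e.1 = 0} → Fin 3 → ℝ) 1, Real.exp (-(a * balLevel L β (balExt L w))) * (a * balLevel L β (balExt L w) + 1) ^ k ≤
      5 * Real.exp 1 * 2 ^ k * 4 ^ Module.finrank ℝ ({e : Edge 3 L // ¬e.1 = 0} → Fin 3 → ℝ) * k.factorial *
          (Module.finrank ℝ ({e : Edge 3 L // ¬e.1 = 0} → Fin 3 → ℝ)).factorial *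
        ((volume {w : {e : Edge 3 L // ¬e.1 = 0} → Fin 3 → ℝ | balLevel L β (balExt L w) ≤ 1}).toReal *
          (a ^ Module.finrank ℝ ({e : Edge 3 L // ¬e.1 = 0} → Fin 3 → ℝ))⁻¹) := by
  haveI : IsFiniteMeasure ((volume : Measure ({e : Edge 3 L // ¬e.1 = 0} → Fin 3 → ℝ)).restrict (Metric.closedBall 0 1)) :=
    isFiniteMeasure_restrict.2 measure_closedBall_lt_top.ne
  have hNm : Measurable fun w : {e : Edge 3 L // ¬e.1 = 0} → Fin 3 → ℝ => a * balLevel L β (balExt L w) :=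
    ((measurable_balLevel L β).comp (balExt L).continuous.measurable).const_mul a
  have hN0 : ∀ w : {e : Edge 3 L // ¬e.1 = 0} → Fin 3 → ℝ, 0 ≤ a * balLevel L β (balExt L w) := fun w =>
    mul_nonneg ha0.le (balLevel_nonneg L (by linarith) _)
  exact integral_exp_neg_mul_pow_le_of_volume_growth _ hNm hN0 (fun t ht => volume_real_scaled_sublevel_le L hβ ha0 ha1 ht) k

/-! ## §3 The transverse master bound -/

/-- The sup norm of `v` is at most the Euclidean norm of `linkEmbed L v`. [folklore] -/
theorem norm_le_norm_linkEmbed (v : Edge 3 L → Fin 3 → ℝ) : ‖v‖ ≤ ‖linkEmbed L v‖ :=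
  (pi_norm_le_iff_of_nonneg (norm_nonneg _)).2 fun e => norm_apply_le_norm_linkEmbed v e

/-- If `‖linkEmbed L (balExt L w)‖ ≤ 1` then `w ∈ closedBall 0 1`. [folklore] -/
theorem mem_closedBall_of_linkEmbed_le {w : {e : Edge 3 L // ¬e.1 = 0} → Fin 3 → ℝ} (hw : ‖linkEmbed L (balExt L w)‖ ≤ 1) :
    w ∈ Metric.closedBall (0 : {e : Edge 3 L // ¬e.1 = 0} → Fin 3 → ℝ) 1 :=
  mem_closedBall_zero_iff.2 ((norm_le_norm_balExt L w).trans ((norm_le_norm_linkEmbed L _).trans hw))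

/-- The record radius tends to `0`: eventually `min (1/40) (powScale (1/2) β·btLog β) < r` for every `r > 0`. [folklore] -/
theorem eventually_recordRadius_lt {r : ℝ} (hr : 0 < r) : ∀ᶠ β : ℝ in atTop, min (1 / 40) (powScale (1 / 2) β * btLog β) < r := by
  filter_upwards [(tendsto_rf).eventually (eventually_lt_nhds hr)] with β hβ using (min_le_right _ _).trans_lt hβ

/-- ★★★ **THE TRANSVERSE MASTER BOUND.**  There are `K > 0` and `β₁` such that for all `β ≥ β₁`, `0 < a ≤ 1`, `k : ℕ`, `D ≥ 0` and every measurable `f ≥ 0` with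
`f v ≤ D·e^{−a·balLevel β v}·(balLevel β v + 1)^k` and `f v ≠ 0 → ‖linkEmbed L v‖ ≤ min (1/40) (powScale (1/2) β·btLog β)`:
`∫ f dπ ≤ K·D·(5e·2^k·4^d·k!·d!)·(a^{k+d})⁻¹·v_β`. [cite: Luscher1983, §3] -/
theorem orthoTransverse_gauss_moment_le :
    ∃ K β₁ : ℝ, 0 < K ∧ 1 ≤ β₁ ∧ ∀ β : ℝ, β₁ ≤ β → ∀ a : ℝ, 0 < a → a ≤ 1 → ∀ (k : ℕ) (D : ℝ), 0 ≤ D →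
      ∀ f : (Edge 3 L → Fin 3 → ℝ) → ℝ, Measurable f → (∀ v, 0 ≤ f v) →
        (∀ v, f v ≤ D * (Real.exp (-(a * balLevel L β v)) * (balLevel L β v + 1) ^ k)) →
        (∀ v, f v ≠ 0 → ‖linkEmbed L v‖ ≤ min (1 / 40) (powScale (1 / 2) β * btLog β)) →
        ∫ v, f v ∂orthoTransverse L ≤
          K * D * (5 * Real.exp 1 * 2 ^ k * 4 ^ Module.finrank ℝ ({e : Edge 3 L // ¬e.1 = 0} → Fin 3 → ℝ) * k.factorial *
              (Module.finrank ℝ ({e : Edge 3 L // ¬e.1 = 0} → Fin 3 → ℝ)).factorial) *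
            (a ^ (k + Module.finrank ℝ ({e : Edge 3 L // ¬e.1 = 0} → Fin 3 → ℝ)))⁻¹ *
            (volume {w : {e : Edge 3 L // ¬e.1 = 0} → Fin 3 → ℝ | balLevel L β (balExt L w) ≤ 1}).toReal := by
  obtain ⟨r₀, hr₀, c, C, hc, hC, h⟩ := orthoTransverse_integral_two_sided L
  obtain ⟨β₁, hβ₁⟩ := Filter.eventually_atTop.mp ((eventually_recordRadius_lt hr₀).and (Filter.eventually_ge_atTop (1 : ℝ)))
  set d := Module.finrank ℝ ({e : Edge 3 L // ¬e.1 = 0} → Fin 3 → ℝ) with hd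
  refine ⟨C, max β₁ 1, hC, le_max_right _ _, fun β hβ a ha0 ha1 k D hD f hf hf0 hfle hfs => ?_⟩
  obtain ⟨hrad, hβ1⟩ := hβ₁ β ((le_max_left _ _).trans hβ)
  haveI : IsFiniteMeasure ((volume : Measure ({e : Edge 3 L // ¬e.1 = 0} → Fin 3 → ℝ)).restrict (Metric.closedBall 0 1)) :=
    isFiniteMeasure_restrict.2 measure_closedBall_lt_top.ne
  set N : ({e : Edge 3 L // ¬e.1 = 0} → Fin 3 → ℝ) → ℝ := fun w => a * balLevel L β (balExt L w) with hN
  have hNm : Measurable N := ((measurable_balLevel L β).comp (balExt L).continuous.measurable).const_mul a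
  have hbal0 : ∀ v, 0 ≤ balLevel L β v := fun v => balLevel_nonneg L (by linarith) v
  have hN0 : ∀ w, 0 ≤ N w := fun w => mul_nonneg ha0.le (hbal0 _)
  -- support and boundedness of `f`
  have hfs' : ∀ v, f v ≠ 0 → ‖v‖ < r₀ := fun v hv => ((norm_le_norm_linkEmbed L v).trans (hfs v hv)).trans_lt hrad
  have hfB : ∃ B : ℝ, ∀ v, f v ≤ B := ⟨D * ((a ^ k)⁻¹ * (2 ^ k * k.factorial * Real.exp (1 / 2))), fun v =>
    (hfle v).trans (mul_le_mul_of_nonneg_left (exp_neg_mul_pow_le_const ha0 ha1 (hbal0 v) k) hD)⟩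
  have hup := (h f hf hf0 hfB hfs').2
  -- the flat integral lives on the closed unit ball
  have hball : ∫ w, f (balExt L w) = ∫ w in Metric.closedBall (0 : {e : Edge 3 L // ¬e.1 = 0} → Fin 3 → ℝ) 1, f (balExt L w) := by
    refine (setIntegral_eq_integral_of_forall_compl_eq_zero fun w hw => ?_).symm
    by_contra hne
    exact hw (mem_closedBall_of_linkEmbed_le L ((hfs _ hne).trans ((min_le_left _ _).trans (by norm_num))))
  -- pointwise domination by the rescaled layer-cake integrand
  have hdom : ∀ w, f (balExt L w) ≤ D * (a ^ k)⁻¹ * (Real.exp (-N w) * (N w + 1) ^ k) := fun w => by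
    have h1 := hfle (balExt L w)
    have h2 := exp_neg_mul_pow_le_scaled ha0 ha1 (hbal0 (balExt L w)) k
    calc f (balExt L w) ≤ D * (Real.exp (-(a * balLevel L β (balExt L w))) * (balLevel L β (balExt L w) + 1) ^ k) := h1
      _ ≤ D * ((a ^ k)⁻¹ * (Real.exp (-(a * balLevel L β (balExt L w))) * (a * balLevel L β (balExt L w) + 1) ^ k)) := mul_le_mul_of_nonneg_left h2 hD
      _ = _ := by rw [hN]; ring
  have hint : Integrable (fun w => D * (a ^ k)⁻¹ * (Real.exp (-N w) * (N w + 1) ^ k))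
      ((volume : Measure ({e : Edge 3 L // ¬e.1 = 0} → Fin 3 → ℝ)).restrict (Metric.closedBall 0 1)) :=
    (integrable_exp_neg_mul_pow _ hNm hN0 k).const_mul _
  have hmono : ∫ w in Metric.closedBall (0 : {e : Edge 3 L // ¬e.1 = 0} → Fin 3 → ℝ) 1, f (balExt L w) ≤
      ∫ w in Metric.closedBall (0 : {e : Edge 3 L // ¬e.1 = 0} → Fin 3 → ℝ) 1, D * (a ^ k)⁻¹ * (Real.exp (-N w) * (N w + 1) ^ k) :=
    integral_mono_of_nonneg (ae_of_all _ fun w => hf0 _) hint (ae_of_all _ hdom)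
  have hcake := flat_gauss_moment_le L hβ1 ha0 ha1 k
  have hv0 : 0 ≤ (volume {w : {e : Edge 3 L // ¬e.1 = 0} → Fin 3 → ℝ | balLevel L β (balExt L w) ≤ 1}).toReal := ENNReal.toReal_nonneg
  have hflat : ∫ w, f (balExt L w) ≤ D * (a ^ k)⁻¹ * (5 * Real.exp 1 * 2 ^ k * 4 ^ d * k.factorial * d.factorial *
      ((volume {w : {e : Edge 3 L // ¬e.1 = 0} → Fin 3 → ℝ | balLevel L β (balExt L w) ≤ 1}).toReal * (a ^ d)⁻¹)) := by
    rw [hball]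
    refine hmono.trans ?_
    rw [integral_const_mul]
    exact mul_le_mul_of_nonneg_left hcake (by positivity)
  calc ∫ v, f v ∂orthoTransverse L ≤ C * ∫ w, f (balExt L w) := hup
    _ ≤ C * (D * (a ^ k)⁻¹ * (5 * Real.exp 1 * 2 ^ k * 4 ^ d * k.factorial * d.factorial *
          ((volume {w : {e : Edge 3 L // ¬e.1 = 0} → Fin 3 → ℝ | balLevel L β (balExt L w) ≤ 1}).toReal * (a ^ d)⁻¹))) := mul_le_mul_of_nonneg_left hflat hC.le
    _ = _ := by rw [pow_add, mul_inv]; ring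

/-! ## §4 The core floor -/

/-- If `y² ≤ N + 1` with `N ≥ 0` and `y ≥ 0` then `y ≤ N + 1`. [folklore] -/
theorem le_add_one_of_sq_le {y N : ℝ} (hy : 0 ≤ y) (hN : 0 ≤ N) (h : y ^ 2 ≤ N + 1) : y ≤ N + 1 := by
  by_cases hy1 : y ≤ 1
  · linarith
  · push Not at hy1; nlinarith

/-- `√β‖x‖ ≤ balLevel β v + 1` for `β ≥ 1` (`x = linkEmbed L v`), hence `(√β‖x‖)^m ≤ (balLevel β v + 1)^m`. [folklore] -/
theorem sqrt_mul_norm_pow_le_balLevel_add_one {β : ℝ} (hβ : 1 ≤ β) (v : Edge 3 L → Fin 3 → ℝ) (m : ℕ) :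
    (Real.sqrt β * ‖linkEmbed L v‖) ^ m ≤ (balLevel L β v + 1) ^ m := by
  have hβ0 : 0 ≤ β := by linarith
  have hN := mul_norm_sq_le_balLevel L hβ v
  have hN0 := balLevel_nonneg L hβ0 v
  refine pow_le_pow_left₀ (by positivity) (le_add_one_of_sq_le (by positivity) hN0 ?_) m
  rw [mul_pow, Real.sq_sqrt hβ0]; linarith

/-- `(1 + β‖x‖²)^m ≤ (balLevel β v + 1)^m` for `β ≥ 1`. [folklore] -/
theorem one_add_mul_norm_sq_pow_le {β : ℝ} (hβ : 1 ≤ β) (v : Edge 3 L → Fin 3 → ℝ) (m : ℕ) :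
    (1 + β * ‖linkEmbed L v‖ ^ 2) ^ m ≤ (balLevel L β v + 1) ^ m := by
  have hN := mul_norm_sq_le_balLevel L hβ v
  exact pow_le_pow_left₀ (by positivity) (by linarith) m

/-- ★ **The quarter sublevel lies in the core and in the support**: for `β ≥ 400` and `balLevel β v ≤ 1/4` with `v` balanced: `v ∈ coreBox β`, `v ∈ capBalancedSet`, and
`‖linkEmbed L v‖ ≤ min (1/40) (powScale (1/2) β·btLog β)`. [folklore] -/
theorem mem_coreBox_of_balLevel_le {β : ℝ} (hβ : 400 ≤ β) {v : Edge 3 L → Fin 3 → ℝ} (hv : v ∈ balancedSet L) (hN : balLevel L β v ≤ 1 / 4) :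
    v ∈ coreBox L β ∧ v ∈ capBalancedSet L ∧ ‖linkEmbed L v‖ ≤ min (1 / 40) (powScale (1 / 2) β * btLog β) := by
  have hβ1 : 1 ≤ β := by linarith
  have hβ0 : 0 < β := by linarith
  have hs0 : 0 < Real.sqrt β := Real.sqrt_pos.2 hβ0
  have hs20 : 20 ≤ Real.sqrt β := by
    rw [show (20 : ℝ) = Real.sqrt 400 by rw [show (400 : ℝ) = 20 ^ 2 by norm_num, Real.sqrt_sq (by norm_num)]]
    exact Real.sqrt_le_sqrt hβ
  set x := linkEmbed L v
  have hNx := mul_norm_sq_le_balLevel L hβ1 v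
  -- `‖x‖ ≤ (√β)⁻¹ / 2 ≤ 1/40`
  have hx : ‖x‖ ≤ (Real.sqrt β)⁻¹ / 2 := by
    have h1 : (Real.sqrt β * ‖x‖) ^ 2 ≤ 1 / 4 := by rw [mul_pow, Real.sq_sqrt hβ0.le]; linarith
    have h2 : Real.sqrt β * ‖x‖ ≤ 1 / 2 := by nlinarith [mul_nonneg hs0.le (norm_nonneg x)]
    rw [le_div_iff₀ (by norm_num : (0 : ℝ) < 2), ← mul_le_mul_iff_of_pos_left hs0]
    calc Real.sqrt β * (‖x‖ * 2) = Real.sqrt β * ‖x‖ * 2 := by ring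
      _ ≤ 1 / 2 * 2 := by linarith
      _ = 1 := by norm_num
      _ = Real.sqrt β * (Real.sqrt β)⁻¹ := (mul_inv_cancel₀ hs0.ne').symm
  have hinv0 : 0 < (Real.sqrt β)⁻¹ := inv_pos.2 hs0
  have hinv20 : (Real.sqrt β)⁻¹ ≤ 1 / 20 := by rw [one_div]; exact inv_anti₀ (by norm_num) hs20
  have hxs : ‖x‖ ≤ (Real.sqrt β)⁻¹ := hx.trans (by linarith)
  have hcoord : ∀ (e : Edge 3 L) (c : Fin 3), |v e c| ≤ (Real.sqrt β)⁻¹ := fun e c => by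
    rw [← Real.norm_eq_abs]
    exact ((norm_le_pi_norm (v e) c).trans (norm_apply_le_norm_linkEmbed v e)).trans hxs
  have hcap : v ∈ capBalancedSet L :=
    mem_capBalancedSet_of_norm_lt L hv (((norm_le_norm_linkEmbed L v).trans hx).trans_lt (by linarith))
  have hpow : (Real.sqrt β)⁻¹ = powScale (1 / 2) β := by
    rw [powScale_eq hβ1, Real.sqrt_eq_rpow, ← Real.rpow_neg hβ0.le]
  refine ⟨⟨hcap, hxs, hcoord⟩, hcap, le_min (hx.trans (by linarith)) ?_⟩
  calc ‖x‖ ≤ (Real.sqrt β)⁻¹ / 2 := hx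
    _ ≤ (Real.sqrt β)⁻¹ * 1 := by linarith
    _ ≤ powScale (1 / 2) β * btLog β := by rw [hpow]; exact mul_le_mul_of_nonneg_left (one_le_btLog β) (powScale_pos _ _).le

/-- The reference core `coreBox β` is measurable. [folklore] -/
theorem measurableSet_coreBox (β : ℝ) : MeasurableSet (coreBox L β) := by
  have h1 : MeasurableSet {v : Edge 3 L → Fin 3 → ℝ | v ∈ capBalancedSet L} := measurableSet_capBalancedSet L
  have h2 : MeasurableSet {v : Edge 3 L → Fin 3 → ℝ | ‖linkEmbed L v‖ ≤ (Real.sqrt β)⁻¹} := measurableSet_le (measurable_linkEmbed L).norm measurable_const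
  have h3 : MeasurableSet {v : Edge 3 L → Fin 3 → ℝ | ∀ (e : Edge 3 L) (c : Fin 3), |v e c| ≤ (Real.sqrt β)⁻¹} := by
    have e : {v : Edge 3 L → Fin 3 → ℝ | ∀ (e : Edge 3 L) (c : Fin 3), |v e c| ≤ (Real.sqrt β)⁻¹} = ⋂ e : Edge 3 L, ⋂ c : Fin 3, {v | |v e c| ≤ (Real.sqrt β)⁻¹} := by
      ext v; simp only [Set.mem_setOf_eq, Set.mem_iInter]
    rw [e]
    exact MeasurableSet.iInter fun e => MeasurableSet.iInter fun c =>
      measurableSet_le (continuous_abs.measurable.comp ((measurable_pi_apply c).comp (measurable_pi_apply e))) measurable_const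
  have e : coreBox L β = {v | v ∈ capBalancedSet L} ∩ ({v | ‖linkEmbed L v‖ ≤ (Real.sqrt β)⁻¹} ∩ {v | ∀ (e : Edge 3 L) (c : Fin 3), |v e c| ≤ (Real.sqrt β)⁻¹}) := by
    ext v; simp only [coreBox, Set.mem_setOf_eq, Set.mem_inter_iff]
  rw [e]; exact h1.inter (h2.inter h3)

/-- The quarter-sublevel volume: `vol{N∘balExt ≤ 1/4} = (1/2)^d·v_β`. [folklore] -/
theorem volume_real_sublevel_quarter (β : ℝ) :
    (volume {w : {e : Edge 3 L // ¬e.1 = 0} → Fin 3 → ℝ | balLevel L β (balExt L w) ≤ 1 / 4}).toReal =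
      (1 / 2) ^ Module.finrank ℝ ({e : Edge 3 L // ¬e.1 = 0} → Fin 3 → ℝ) * (volume {w : {e : Edge 3 L // ¬e.1 = 0} → Fin 3 → ℝ | balLevel L β (balExt L w) ≤ 1}).toReal := by
  rw [volume_sublevel_eq L β (by norm_num : (0 : ℝ) < 1 / 4), ENNReal.toReal_mul, ENNReal.toReal_ofReal (pow_nonneg (Real.sqrt_nonneg _) _)]
  rw [show (1 / 4 : ℝ) = (1 / 2) ^ 2 by norm_num, Real.sqrt_sq (by norm_num)]

/-- ★ The unit sublevel volume `v_β` is positive (as a real number), `β ≥ 1`. [folklore] -/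
theorem volume_real_sublevel_one_pos {β : ℝ} (hβ : 1 ≤ β) : 0 < (volume {w : {e : Edge 3 L // ¬e.1 = 0} → Fin 3 → ℝ | balLevel L β (balExt L w) ≤ 1}).toReal :=
  ENNReal.toReal_pos (volume_sublevel_one_pos L β).ne' (volume_sublevel_one_lt_top L hβ).ne

/-- ★★★ **THE CORE FLOOR.**  There are `k₀ > 0` and `β₂` such that for `β ≥ β₂`:  `k₀·v_β ≤ ∫_{coreBox β} recordProfile β (linkEmbed v) dπ` (`v_β = vol{balLevel β ∘ balExt ≤ 1}`) —
the lower Gaussian sandwich `e^{−50N} ≤ Ω` on the quarter sublevel `{N ≤ 1/4} ⊆ coreBox β`, the lower half of (E′)-lite, and `vol{N ≤ 1/4} = 2^{−d}v_β`. [cite: Luscher1983, §3] -/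
theorem recordProfile_core_floor :
    ∃ k₀ β₂ : ℝ, 0 < k₀ ∧ 400 ≤ β₂ ∧ ∀ β : ℝ, β₂ ≤ β →
      k₀ * (volume {w : {e : Edge 3 L // ¬e.1 = 0} → Fin 3 → ℝ | balLevel L β (balExt L w) ≤ 1}).toReal ≤
        ∫ v in coreBox L β, recordProfile L β (linkEmbed L v) ∂orthoTransverse L := by
  obtain ⟨r₀, hr₀, c, C, hc, hC, h⟩ := orthoTransverse_integral_two_sided L
  obtain ⟨β₁, hβ₁⟩ := Filter.eventually_atTop.mp (eventually_recordRadius_lt hr₀)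
  set d := Module.finrank ℝ ({e : Edge 3 L // ¬e.1 = 0} → Fin 3 → ℝ) with hd
  obtain ⟨hΩm, hΩ01, -, -⟩ := recordProfile_fields L
  refine ⟨c * (Real.exp (-(25 / 2)) * (1 / 2) ^ d), max β₁ 400, by positivity, le_max_right _ _, fun β hβ => ?_⟩
  have hrad := hβ₁ β ((le_max_left _ _).trans hβ)
  have hβ400 : 400 ≤ β := (le_max_right _ _).trans hβ
  have hβ1 : 1 ≤ β := by linarith
  -- the integrand `g = 𝟙_{coreBox β}·Ω∘linkEmbed`
  set g : (Edge 3 L → Fin 3 → ℝ) → ℝ := (coreBox L β).indicator fun v => recordProfile L β (linkEmbed L v) with hg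
  have hgm : Measurable g := ((hΩm β).comp (measurable_linkEmbed L)).indicator (measurableSet_coreBox L β)
  have hg0 : ∀ v, 0 ≤ g v := fun v => Set.indicator_nonneg (fun v _ => (hΩ01 β _).1) v
  have hg1 : ∀ v, g v ≤ 1 := fun v => Set.indicator_le' (fun v _ => (hΩ01 β _).2) (fun _ _ => zero_le_one) v
  have hgs : ∀ v, g v ≠ 0 → ‖v‖ < r₀ := fun v hv0 => by
    have hv : v ∈ coreBox L β := by by_contra hn; exact hv0 (Set.indicator_of_notMem hn _)
    rw [hg, Set.indicator_of_mem hv] at hv0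
    exact ((norm_le_norm_linkEmbed L v).trans (recordProfile_support L hv0).2.2).trans_lt hrad
  have hlow := (h g hgm hg0 ⟨1, hg1⟩ hgs).1
  rw [← integral_indicator (measurableSet_coreBox L β)]
  refine le_trans ?_ hlow
  -- the flat integral is at least `e^{−25/2}·vol{N∘balExt ≤ 1/4}`
  have hSm := measurableSet_sublevel L β (1 / 4)
  have hint : Integrable (fun w : {e : Edge 3 L // ¬e.1 = 0} → Fin 3 → ℝ => g (balExt L w)) := by
    have hmaj : Integrable (fun w : {e : Edge 3 L // ¬e.1 = 0} → Fin 3 → ℝ =>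
        (Metric.closedBall (0 : {e : Edge 3 L // ¬e.1 = 0} → Fin 3 → ℝ) 1).indicator (fun _ => (1 : ℝ)) w) :=
      (integrable_indicator_iff measurableSet_closedBall).2 (integrableOn_const (measure_closedBall_lt_top.ne))
    refine hmaj.mono' (hgm.comp (balExt L).continuous.measurable).aestronglyMeasurable (ae_of_all _ fun w => ?_)
    rw [Real.norm_eq_abs, abs_of_nonneg (hg0 _)]
    by_cases hw : g (balExt L w) = 0
    · rw [hw]; exact Set.indicator_nonneg (fun _ _ => zero_le_one) _
    · have hv : balExt L w ∈ coreBox L β := by by_contra hn; exact hw (Set.indicator_of_notMem hn _)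
      rw [Set.indicator_of_mem (mem_closedBall_of_linkEmbed_le L (hv.2.1.trans ((inv_le_one_of_one_le₀ (by
        rw [show (1 : ℝ) = Real.sqrt 1 by rw [Real.sqrt_one]]; exact Real.sqrt_le_sqrt hβ1)))))]
      exact hg1 _
  have hpt : ∀ w : {e : Edge 3 L // ¬e.1 = 0} → Fin 3 → ℝ,
      {w : {e : Edge 3 L // ¬e.1 = 0} → Fin 3 → ℝ | balLevel L β (balExt L w) ≤ 1 / 4}.indicator (fun _ => Real.exp (-(25 / 2))) w ≤ g (balExt L w) := fun w => by
    by_cases hw : balLevel L β (balExt L w) ≤ 1 / 4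
    · obtain ⟨hcore, hcap, hsup⟩ := mem_coreBox_of_balLevel_le L hβ400 (balExt_mem_balancedSet L w) hw
      rw [Set.indicator_of_mem (show w ∈ {w : {e : Edge 3 L // ¬e.1 = 0} → Fin 3 → ℝ | balLevel L β (balExt L w) ≤ 1 / 4} from hw), hg,
        Set.indicator_of_mem hcore]
      refine le_trans (Real.exp_le_exp.2 ?_) (exp_neg_le_recordProfile L hβ1 hcap hsup)
      linarith
    · rw [Set.indicator_of_notMem (show w ∉ {w : {e : Edge 3 L // ¬e.1 = 0} → Fin 3 → ℝ | balLevel L β (balExt L w) ≤ 1 / 4} from hw)]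
      exact hg0 _
  have hmono := integral_mono_of_nonneg (μ := (volume : Measure ({e : Edge 3 L // ¬e.1 = 0} → Fin 3 → ℝ)))
    (ae_of_all _ fun w => Set.indicator_nonneg (fun _ _ => (Real.exp_pos _).le) w) hint (ae_of_all _ hpt)
  rw [integral_indicator_const _ hSm, smul_eq_mul, measureReal_def, volume_real_sublevel_quarter L β] at hmono
  calc c * (Real.exp (-(25 / 2)) * (1 / 2) ^ d) * (volume {w : {e : Edge 3 L // ¬e.1 = 0} → Fin 3 → ℝ | balLevel L β (balExt L w) ≤ 1}).toReal
      = c * ((1 / 2) ^ d * (volume {w : {e : Edge 3 L // ¬e.1 = 0} → Fin 3 → ℝ | balLevel L β (balExt L w) ≤ 1}).toReal * Real.exp (-(25 / 2))) := by ring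
    _ ≤ c * ∫ w, g (balExt L w) := mul_le_mul_of_nonneg_left hmono hc.le

end Summit.QuantumFields.YangMills.Theorems.FemtoTransferGap.TwoLattice.ConstTube

end
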